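import Summits.Ventures.HSemireg.Pad4TowerPermWindow

/-!
# Venture HSemireg — PAD-4 on 𝔅(μ₄): the PHASE TORUS `(ℤ∕4)⁴` acting on cells, its twist of the class tensor, the
# determinant-one torus `T` (order 64) fixing the μ-word, and the CLEAN-WINDOW LATTICE inside `T`: exactly SIX clean subgroups
# `{1} ⊂ ⟨Δ²⟩ ⊂ ⟨Δ⟩, ⟨γ₁⟩, ⟨γ₂⟩, ⟨γ₃⟩`, with `Δ² = (−1,−1,−1,−1)` IN EVERY NON-TRIVIAL ONE (IDEATOR LINE 4 ∕ RESULT 15 (1), kernel form)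

HONEST FRAMING. Lean index of the computation cell `pub-hsemireg` (S4-PUSH, H2 door PAD-4), typed by the Ventures-side typer
`hodge-lit-semireg-typer-2` (g5; line of record stmt-HodgeConjecture-18881 `Cruxes/BlochSeedDiscOne/Lines/birth.lean` 814a6a70c14e831a,
stub `stub_rung_pad4_seedAt`, screen (H1) = the class condition (A1)). Eighth file of the KERNEL LEMMA Ψ ⊂ (A1) set; sequel of
`Pad4TowerDeltaWindow` (Δ = (i,i,i,i), p601410) and `Pad4TowerPermWindow` (S₄, `G₁ = ⟨Δ⟩ × S₄`, p605333). THIS FILE types the GROUP under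
rows W14 ∕ W14b ∕ W14c ∕ W14d of card v4.15 (bc5-plan g6): the torus of per-factor phase rotations `β_f ↦ i^{η_f} β_f`, `η ∈ (ℤ∕4)⁴`, and its
clean subgroups — bc5-plan g6 IDEATOR LINE 3 «THE CLEAN-WINDOW ATLAS» (cell INBOX l.31806; card row W14c: «"Clean window" = a symmetry
subgroup containing NO pure partial phase move (non-trivial phases on some but not all factors, no permutation) … the torus is forced to
T = {ζ ∈ μ₄⁴ : Πζ_f = 1} (order 64; ζ ∉ T rescales μ). (1) INSIDE T exactly SIX clean subgroups: {1} ⊂ ⟨Δ²⟩ ⊂ ⟨Δ⟩, ⟨γ₁⟩, ⟨γ₂⟩, ⟨γ₃⟩, the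
four of order 4 MAXIMAL (Δ² = total flip is the only clean involution ⇒ no clean (ℤ∕2)², nothing of order ≥ 8)»; torus_windows.py
aed8ecb1cabf8a65, output «|T| = 64 | clean elements incl. identity: 22 | clean subgroups: 6»), IDEATOR LINE 4 «⟨Δ²⟩ IS THE BOTTOM OF THE
CLEAN LATTICE» (l.32037: «… ⟨Δ²⟩ is contained in every non-trivial one. Hence: a support closed under ANY non-trivial clean phase symmetry …
is ⟨Δ²⟩-closed»), ×2 gs-eng-2 g51 RESULT 15 (1) (l.32053: «enumerating all subgroups of T … generated by ≤ 3 elements and keeping those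
whose every non-identity element moves ALL four phases: exactly SIX … and (2,2,2,2) ∈ every non-trivial one … CONFIRMED»), s4-ref-2 g29 (C)
(director-hodge g12 R12.2 (2) l.31785: «⟨Δ⟩ (S₄-fixed) AND three S₄-conjugate groups of type ⟨(i,i,−i,−i)⟩»). Here the classification is a
KERNEL THEOREM about ALL finite subsets of `(ℤ∕4)⁴` containing `0` and closed under addition (not only ≤ 3 generators).

CONTENT (all PROVED; no `sorry`; axioms standard).
* §1 `PVec = Fin 4 → Fin 4` (exponent vectors `η`, `ζ_f = i^{η_f}`), `pv`, `dVec = (1,1,1,1)` (Δ), `d2Vec = (2,2,2,2)` (Δ²), `gVec j`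
  (γ₁ = (1,1,3,3), γ₂ = (1,3,1,3), γ₃ = (1,3,3,1)); `phasePt k` (`β ↦ i^k β`; `phasePt_one = deltaPt`, `phasePt_eq_iterate`, `phasePt_add`),
  **`MCell.phase η`** (`phase_zero`, `phase_add`, `phase_injective`, `phase_dVec = MCell.delta`, `perm_phase`: S₄ permutes the coordinates of `η`).
* §2 `texp η w = Σ_f η_f · twExp(w_f)`, **`twistT η w = i^{texp}`**, `bphi_phasePt`, **`MCell.ch_phase`: `ch(η·Z)(w) = i^{Σ_f η_f (n_e−n_ē)_f} ·
  ch(Z)(w)`** (generalises `MCell.ch_delta`); `twistT_eq_one_of_eFree`; `classScreen_mul_of_eFree_one` ⇒ **`classScreen_twistT`: (A1) is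
  η-stable for EVERY `η ∈ (ℤ∕4)⁴`**; `gI_pow_eq_one_iff`; `DetOne η` (`Ση_f = 0` in `ℤ∕4`), `detOne_iff_val`, **`twistT_eWord_eq_one_iff`:
  the μ-word `eeee` is fixed by `η` iff `η ∈ T`** («ζ ∉ T rescales μ»), `twistT_ebarWord_of_detOne`.
* §3 THE CLEAN LATTICE. `IsPartial η` (a partial phase move: trivial on some factor, non-trivial on another), `torusT`, **`card_torusT`**
  (`|T| = 64`, 22 non-partial elements); `CleanSub H` (a finite set of phase vectors containing `0`, closed under `+` — hence a subgroup —,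
  inside `T`, with NO partial move); `cyc4`, the six sets `trivSub, d2Sub, dSub, gSub j`; **`cleanSub_six`** (they are clean subgroups);
  `CleanGen`, `tenSet`, `cleanGen_iff_mem_tenSet` (the 9 non-trivial clean generators), `pair_mem_cyc4`, `cyc4_cases`;
  **`d2Vec_mem_of_cleanSub`: Δ² LIES IN EVERY NON-TRIVIAL CLEAN SUBGROUP** (LINE 4's dominance), `d2Sub_subset_of_cleanSub`;
  **`cleanSub_classification`: a clean subgroup is one of the SIX**; `cleanSub_card_maximal` (orders 1, 2, 4; the order-4 ones maximal),
  `d2Vec_unique_clean_involution`.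
* §4 probes (`decide`): `torus_probes` (γ_j² = Δ² = Δ·Δ; Δ·γ₁ = (2,2,0,0) is a partial move — why ⟨Δ, γ⟩ is not clean), `gVec_conjugate`
  (the γ's are S₄-conjugate; Δ, Δ² are S₄-fixed), `gVec_stabiliser_card` (the window ⟨γ₁⟩ has S₄-stabiliser of order 8 — card W14b: «the
  split {12}{34} (order 8)» —, the vector γ₁ order 4), `phase_probe` on the four-phase FC cell.

WHAT IS NOT HERE ∕ NOT IN LEAN. The Δ²-window consequences (640 ∕ 398 rows, ⟨Δ²⟩- and ⟨Δ²⟩×S₄-averaging WLOG, γ-window counts):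
sequel `Pad4TowerDelta2Window`; twisted windows `T ⋊ S₄` of LINE 3 (2), Burnside ∕ orbit counts, encoders, SAT verdicts, E10's `H₂`: not
here. Whether any clean-symmetric cell carries a static-clean (H1)-feasible support is a kit question (rows W14, W14d), NOT a Lean statement;
typing these premises authorises no compute (director-hodge g12 l.32075). That the frame IS `H^{ev}(S⁴)` and `η` the CM automorphisms'
action stays the cell's pencil modelling sentence (LINE 2 §1). No variety, sheaf, σ, seed or abelian variety; NOTHING HERE SAYS THAT HC ∕
HC_CM ∕ HC_AV ∕ W₆ ∕ HC_Kum4Type HOLDS OR FAILS. No `instance`, no notation, no named fact, 0 `sorry`.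

SOURCES (sha16 ∕ bus): bc5-plan g6 IDEATOR LINE 3 cell INBOX l.31806, LINE 4 l.32037, card `birth-v4.md` v4.15 96eae72e810e9d81 rows W14b ∕
W14c; torus_windows.py aed8ecb1cabf8a65 (+ .out.txt); gamma_counts.py 26935a2ec1c3f1de; gs-eng-2 g51 RESULT 15 l.32053; director-hodge g12
RULING R12.2 (2) l.31785 (s4-ref-2 g29 (C)); tree `Pad4TowerDeltaWindow.lean` 85a2925c82a6c0e4 (p601410), `Pad4TowerPermWindow.lean`
28becaea892846f5 (p605333).
-/

namespace Summit.Ventures.HSemireg.Pad4Tower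

open Finset

/-! ## §1 Phase vectors and the phase action on factor points and cells -/

/-- a PHASE (exponent) VECTOR `η ∈ (ℤ∕4)⁴`: the per-factor rotation `β_f ↦ i^{η_f} β_f` (`ζ_f = i^{η_f} ∈ μ₄`). -/
abbrev PVec := Fin 4 → Fin 4

/-- phase-vector constructor. -/
def pv (a b c d : Fin 4) : PVec := ![a, b, c, d]

/-- `Δ = (i,i,i,i)` as an exponent vector: `(1,1,1,1)`. -/
def dVec : PVec := pv 1 1 1 1

/-- `Δ² = (−1,−1,−1,−1)`, the TOTAL SIGN FLIP: `(2,2,2,2)`. -/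
def d2Vec : PVec := pv 2 2 2 2

/-- the three γ's: `γ₁ = (i,i,−i,−i) = (1,1,3,3)`, `γ₂ = (i,−i,i,−i) = (1,3,1,3)`, `γ₃ = (i,−i,−i,i) = (1,3,3,1)` (card row W14b). -/
def gVec : Fin 3 → PVec := ![pv 1 1 3 3, pv 1 3 1 3, pv 1 3 3 1]

/-- rotate ONE factor point by `i^k`: `β ↦ i^k β` (`k = 1`: `(α, −Im β, Re β)` = `deltaPt`; `k = 2`: `β ↦ −β`). -/
def phasePt (k : Fin 4) (x : BPoint) : BPoint :=
  (x.1, ![x.2.1, -x.2.2, -x.2.1, x.2.2] k, ![x.2.2, x.2.1, -x.2.2, -x.2.1] k)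

/-- phase `1` is `Pad4TowerDeltaWindow.deltaPt`. -/
theorem phasePt_one (x : BPoint) : phasePt 1 x = deltaPt x := rfl

/-- `phasePt k` is the `k`-th iterate of `deltaPt`. -/
theorem phasePt_eq_iterate (k : Fin 4) (x : BPoint) : phasePt k x = deltaPt^[k.val] x := by
  fin_cases k <;> simp [phasePt, deltaPt]

/-- the phase action on a point is additive in the exponent (`i^{a+b} = i^a i^b`). -/
theorem phasePt_add (a b : Fin 4) (x : BPoint) : phasePt (a + b) x = phasePt a (phasePt b x) := by
  fin_cases a <;> fin_cases b <;> simp [phasePt]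

/-- **the PHASE ACTION of `η ∈ (ℤ∕4)⁴` on a 𝔅(μ₄) cell**: factor `f` rotated by `i^{η_f}`. -/
def MCell.phase (η : PVec) (Z : MCell) : MCell := fun f => phasePt (η f) (Z f)

/-- the zero vector acts trivially. -/
theorem MCell.phase_zero (Z : MCell) : Z.phase 0 = Z := rfl

/-- the action is additive: `(a + b)·Z = a·(b·Z)`. -/
theorem MCell.phase_add (a b : PVec) (Z : MCell) : Z.phase (a + b) = (Z.phase b).phase a := by
  funext f
  exact phasePt_add (a f) (b f) (Z f)

/-- four times any phase vector is zero, so `η` acts with inverse `η + η + η`. -/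
theorem MCell.phase_cancel (η : PVec) (Z : MCell) : (Z.phase η).phase (η + η + η) = Z := by
  rw [← MCell.phase_add]
  have h : η + η + η + η = 0 := funext fun f => by
    have : ∀ a : Fin 4, a + a + a + a = 0 := by decide
    exact this (η f)
  rw [h, MCell.phase_zero]

/-- each phase vector acts injectively on cells. -/
theorem MCell.phase_injective (η : PVec) : Function.Injective (MCell.phase η) := fun Z Z' h => by
  rw [← Z.phase_cancel η, ← Z'.phase_cancel η, h]

/-- `Δ` of `Pad4TowerDeltaWindow` is the phase vector `(1,1,1,1)`. -/
theorem MCell.phase_dVec (Z : MCell) : Z.phase dVec = Z.delta := by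
  funext f
  have h : ∀ g : Fin 4, dVec g = 1 := by decide
  show phasePt (dVec f) (Z f) = _
  rw [h, phasePt_one]
  rfl

/-- a factor permutation acting on phase vectors (coordinates permuted as for words and cells). -/
def permP (σ : Equiv.Perm (Fin 4)) (η : PVec) : PVec := fun f => η (σ f)

/-- **S₄ normalises the torus by permuting coordinates**: `σ·(η·Z) = (σ·η)·(σ·Z)`. -/
theorem MCell.perm_phase (σ : Equiv.Perm (Fin 4)) (η : PVec) (Z : MCell) :
    (Z.phase η).perm σ = (Z.perm σ).phase (permP σ η) := rfl

/-! ## §2 The twist of the class tensor under a phase vector; (A1) is stable; the μ-word is fixed exactly on `T` -/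

/-- the twist exponent of a word under `η`: `Σ_f η_f · twExp(w_f)` (`e ↦ η_f`, `ē ↦ 3η_f`, real letters `↦ 0`), i.e.
`Σ_f η_f (n_e − n_ē)_f (mod 4)`. -/
def texp (η : PVec) (w : CWord) : ℕ :=
  (η 0).val * twExp (w 0) + (η 1).val * twExp (w 1) + (η 2).val * twExp (w 2) + (η 3).val * twExp (w 3)

/-- the twist of a word under `η`: `i^{texp η w}`. -/
def twistT (η : PVec) (w : CWord) : GaussianInt := gI ^ texp η w

/-- iterating `deltaPt` multiplies each letter entry by the corresponding power of `i^{twExp}`. -/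
theorem bphi_deltaPt_iterate (n : ℕ) (x : BPoint) (l : Fin 6) : bphi (deltaPt^[n] x) l = gI ^ (n * twExp l) * bphi x l := by
  induction n with
  | zero => simp
  | succ n ih => rw [Function.iterate_succ_apply', bphi_deltaPt, ih]; ring

/-- `phasePt k` multiplies the letter entries by `(1, 1, 1, i^k, i^{3k}, 1)`. -/
theorem bphi_phasePt (k : Fin 4) (x : BPoint) (l : Fin 6) : bphi (phasePt k x) l = gI ^ (k.val * twExp l) * bphi x l := by
  rw [phasePt_eq_iterate, bphi_deltaPt_iterate]

/-- **A PHASE VECTOR TWISTS THE CLASS TENSOR WORD BY WORD**: `ch(η·Z)(w) = i^{Σ_f η_f (n_e − n_ē)_f} · ch(Z)(w)`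
(generalises `MCell.ch_delta`: `η = (1,1,1,1)` gives `i^{n_e − n_ē}`). -/
theorem MCell.ch_phase (η : PVec) (Z : MCell) (w : CWord) : (Z.phase η).ch w = twistT η w * Z.ch w := by
  simp only [MCell.ch, chTensor, MCell.phase, bphi_phasePt, twistT, texp, pow_add, pow_mul]
  ring

/-- e-free words are not twisted by any phase vector. -/
theorem twistT_eq_one_of_eFree (η : PVec) (w : CWord) (hw : EFree w) : twistT η w = 1 := by
  have h : ∀ f, twExp (w f) = 0 := fun f => by
    obtain ⟨h3, h4⟩ := hw f
    generalize w f = l at h3 h4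
    fin_cases l <;> simp_all [twExp]
  simp [twistT, texp, h]

/-- multiplying a class function word by word by a factor that is `1` on every e-free word preserves the class screen. -/
theorem classScreen_mul_of_eFree_one {R : Type*} [CommRing R] (u T : CWord → R) (hu : ∀ w, EFree w → u w = 1)
    (h : ClassScreen T) : ClassScreen fun w => u w * T w := by
  obtain ⟨h0, hd⟩ := h
  refine ⟨fun w hw h1 h2 => by simp [h0 w hw h1 h2], fun w w' hw hw' hdeg => ?_⟩
  simp [hu w hw, hu w' hw', hd w w' hw hw' hdeg]

/-- **(A1) IS STABLE UNDER THE WHOLE TORUS `(ℤ∕4)⁴`**: twisting by any phase vector preserves the class screen (e-free words are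
untouched, mixed words stay `0`) — card W14b: «the static game is covariant under every element of μ₄⁴». -/
theorem classScreen_twistT (η : PVec) {T : CWord → GaussianInt} (h : ClassScreen T) : ClassScreen fun w => twistT η w * T w :=
  classScreen_mul_of_eFree_one _ T (twistT_eq_one_of_eFree η) h

/-- `iⁿ = 1` iff `4 ∣ n`. -/
theorem gI_pow_eq_one_iff (n : ℕ) : gI ^ n = 1 ↔ n % 4 = 0 := by
  have h4 : gI ^ 4 = 1 := by decide
  have key : gI ^ n = gI ^ (n % 4) := by
    conv_lhs => rw [← Nat.mod_add_div n 4, pow_add, pow_mul, h4, one_pow, mul_one]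
  rw [key]
  have h := Nat.mod_lt n (by norm_num : 0 < 4)
  generalize n % 4 = r at h ⊢
  interval_cases r <;> decide

/-- **`η ∈ T`**, the DETERMINANT-ONE TORUS: `Π_f ζ_f = 1`, i.e. `Σ_f η_f = 0` in `ℤ∕4`. Decidable. -/
abbrev DetOne (η : PVec) : Prop := η 0 + η 1 + η 2 + η 3 = 0

/-- `η ∈ T` iff `4 ∣ Σ_f η_f` as natural numbers. -/
theorem detOne_iff_val (η : PVec) : DetOne η ↔ ((η 0).val + (η 1).val + (η 2).val + (η 3).val) % 4 = 0 := by
  simp only [DetOne, Fin.ext_iff, Fin.val_add, Fin.val_zero]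
  omega

/-- **THE μ-WORD IS FIXED EXACTLY ON `T`**: `η·eeee = eeee` (twist `1`) iff `η ∈ T` — «ζ ∉ T rescales μ» (card W14c), «the
W-fixing torus T = {Πζ_f = 1} ⊂ μ₄⁴ (order 64)» (card W14). -/
theorem twistT_eWord_eq_one_iff (η : PVec) : twistT η eWord = 1 ↔ DetOne η := by
  have e : texp η eWord = (η 0).val + (η 1).val + (η 2).val + (η 3).val := by simp [texp, eWord, twExp]
  rw [twistT, e, gI_pow_eq_one_iff, detOne_iff_val]

/-- on `T` the conjugate μ-word `ēēēē` is fixed as well (twist `i^{3Σ η_f}`). -/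
theorem twistT_ebarWord_of_detOne (η : PVec) (h : DetOne η) : twistT η ebarWord = 1 := by
  have e : texp η ebarWord = 3 * ((η 0).val + (η 1).val + (η 2).val + (η 3).val) := by
    simp [texp, ebarWord, twExp]
    ring
  rw [twistT, e, gI_pow_eq_one_iff]
  rw [detOne_iff_val] at h
  omega

/-! ## §3 The clean-window lattice inside `T`: exactly six clean subgroups, `Δ²` in every non-trivial one -/

/-- a PARTIAL PHASE MOVE («proper support»: torus_windows.py `proper`): non-trivial on some factor AND trivial on some factor. Decidable. -/
abbrev IsPartial (η : PVec) : Prop := (∃ f, η f = 0) ∧ ∃ f, η f ≠ 0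

/-- the torus `T` as a finite set of exponent vectors. -/
def torusT : Finset PVec := univ.filter fun η => DetOne η

/-- **`|T| = 64`**, and `T` has `22` elements that are not partial moves (identity + 21 moving all four phases) — torus_windows.out:
«|T| = 64 | clean elements incl. identity: 22». [kernel, `decide`] -/
theorem card_torusT : torusT.card = 64 ∧ (torusT.filter fun η => ¬ IsPartial η).card = 22 := by
  decide +kernel

/-- **A CLEAN SUBGROUP OF `T`** («clean subgroup = no proper-support element», torus_windows.py; RESULT 15 (1): «every non-identity
element moves ALL four phases»), as a finite set of exponent vectors: it contains `0`, is closed under addition (so it is a subgroup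
of the finite group `(ℤ∕4)⁴`), lies in `T`, and contains NO partial phase move. -/
def CleanSub (H : Finset PVec) : Prop :=
  0 ∈ H ∧ (∀ a ∈ H, ∀ b ∈ H, a + b ∈ H) ∧ (∀ a ∈ H, DetOne a) ∧ ∀ a ∈ H, ¬ IsPartial a

/-- the cyclic set generated by `a`: `{0, a, 2a, 3a}`. -/
def cyc4 (a : PVec) : Finset PVec := {0, a, a + a, a + a + a}

/-- `{1}`. -/
def trivSub : Finset PVec := {0}

/-- `⟨Δ²⟩ = {1, (−1,−1,−1,−1)}`. -/
def d2Sub : Finset PVec := {0, d2Vec}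

/-- `⟨Δ⟩ = {1, Δ, Δ², Δ³}`. -/
def dSub : Finset PVec := cyc4 dVec

/-- `⟨γ_j⟩ = {1, γ_j, γ_j² = Δ², γ_j³}` for the three γ's. -/
def gSub (j : Fin 3) : Finset PVec := cyc4 (gVec j)

set_option synthInstance.maxSize 8192 in -- the conjunction of bounded quantifiers needs a larger instance term
/-- **THE SIX ARE CLEAN SUBGROUPS OF `T`** (torus_windows.out: orders 1, 2, 4, 4, 4, 4). [kernel, `decide`] -/
theorem cleanSub_six : CleanSub trivSub ∧ CleanSub d2Sub ∧ CleanSub dSub ∧ ∀ j : Fin 3, CleanSub (gSub j) := by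
  unfold CleanSub trivSub d2Sub dSub gSub cyc4
  exact ⟨by decide +kernel, by decide +kernel, by decide +kernel, by decide +kernel⟩

/-- `η` GENERATES A CLEAN CYCLIC SUBGROUP OF `T`: `η ∈ T` and none of `η, 2η, 3η` is a partial move. Decidable. -/
abbrev CleanGen (η : PVec) : Prop := DetOne η ∧ ¬ IsPartial η ∧ ¬ IsPartial (η + η) ∧ ¬ IsPartial (η + η + η)

/-- the ten clean generators: `0, Δ, Δ², Δ³, γ_j, γ_j³`. -/
def tenSet : Finset PVec :=
  {0, dVec, d2Vec, pv 3 3 3 3, pv 1 1 3 3, pv 3 3 1 1, pv 1 3 1 3, pv 3 1 3 1, pv 1 3 3 1, pv 3 1 1 3}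

/-- **the clean cyclic generators inside `T` are exactly the ten listed** (s4-ref-2 g29 (C), R12.2 (2): «the proper-support-free cyclic
subgroups are ⟨Δ⟩ and three S₄-conjugate groups of type ⟨(i,i,−i,−i)⟩» — plus `⟨Δ²⟩`). [kernel, `decide` over all 256 vectors] -/
theorem cleanGen_iff_mem_tenSet : ∀ η : PVec, CleanGen η ↔ η ∈ tenSet := by
  unfold tenSet
  decide +kernel

set_option synthInstance.maxSize 8192 in -- nested bounded quantifiers
/-- PAIRS: if `a` is a clean generator of order 4 and `b` a clean generator with `a + b` not a partial move, then `b ∈ ⟨a⟩` — two different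
order-4 clean groups cannot sit in one clean subgroup (`Δ·γ₁ = (2,2,0,0)` etc.). [kernel, `decide` over the 100 pairs] -/
theorem pair_mem_cyc4 : ∀ a ∈ tenSet, ∀ b ∈ tenSet, a ≠ 0 → a ≠ d2Vec → ¬ IsPartial (a + b) → b ∈ cyc4 a := by
  unfold tenSet cyc4
  decide +kernel

set_option synthInstance.maxSize 8192 in -- nested decidable implications
/-- the cyclic group of an order-4 clean generator is `⟨Δ⟩` or one of the `⟨γ_j⟩`. [kernel, `decide`] -/
theorem cyc4_cases : ∀ a ∈ tenSet, a ≠ 0 → a ≠ d2Vec → cyc4 a = dSub ∨ cyc4 a = gSub 0 ∨ cyc4 a = gSub 1 ∨ cyc4 a = gSub 2 := by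
  unfold tenSet dSub gSub
  decide +kernel

/-- every element of a clean subgroup is a clean generator (its multiples lie in the subgroup). -/
theorem CleanSub.cleanGen {H : Finset PVec} (hH : CleanSub H) {a : PVec} (ha : a ∈ H) : CleanGen a :=
  ⟨hH.2.2.1 a ha, hH.2.2.2 a ha, hH.2.2.2 _ (hH.2.1 a ha a ha), hH.2.2.2 _ (hH.2.1 _ (hH.2.1 a ha a ha) a ha)⟩

/-- **LINE 4's DOMINANCE: `Δ² = (−1,−1,−1,−1)` LIES IN EVERY NON-TRIVIAL CLEAN SUBGROUP OF `T`** («⟨Δ²⟩ is contained in every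
non-trivial one. Hence: a support closed under ANY non-trivial clean phase symmetry … is ⟨Δ²⟩-closed», l.32037; RESULT 15 (1)
«(2,2,2,2) ∈ every non-trivial one»): any non-zero element `a` of a clean subgroup has `2a = Δ²` or `a = Δ²`. -/
theorem d2Vec_mem_of_cleanSub {H : Finset PVec} (hH : CleanSub H) {a : PVec} (ha : a ∈ H) (ha0 : a ≠ 0) : d2Vec ∈ H := by
  have key : ∀ η : PVec, CleanGen η → η ≠ 0 → η + η = d2Vec ∨ η = d2Vec := by
    intro η hη
    rw [cleanGen_iff_mem_tenSet] at hη
    revert η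
    unfold tenSet
    decide +kernel
  rcases key a (hH.cleanGen ha) ha0 with h | h
  · exact h ▸ hH.2.1 a ha a ha
  · exact h ▸ ha

/-- **THE CLASSIFICATION: A CLEAN SUBGROUP OF `T` IS ONE OF THE SIX** `{1}, ⟨Δ²⟩, ⟨Δ⟩, ⟨γ₁⟩, ⟨γ₂⟩, ⟨γ₃⟩` (torus_windows.out «clean
subgroups: 6»; RESULT 15 (1) «exactly SIX»), for EVERY finite subset of `(ℤ∕4)⁴` satisfying `CleanSub` — no bound on generators. -/
theorem cleanSub_classification {H : Finset PVec} (hH : CleanSub H) :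
    H = trivSub ∨ H = d2Sub ∨ H = dSub ∨ H = gSub 0 ∨ H = gSub 1 ∨ H = gSub 2 := by
  have h0 := hH.1
  have hadd := hH.2.1
  have hten : ∀ a ∈ H, a ∈ tenSet := fun a ha => (cleanGen_iff_mem_tenSet a).1 (hH.cleanGen ha)
  by_cases hex : ∃ a ∈ H, a ≠ 0 ∧ a ≠ d2Vec
  · obtain ⟨a, ha, ha0, ha2⟩ := hex
    have hsub : H ⊆ cyc4 a := fun b hb =>
      pair_mem_cyc4 a (hten a ha) b (hten b hb) ha0 ha2 (hH.2.2.2 _ (hadd a ha b hb))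
    have hsup : cyc4 a ⊆ H := by
      intro b hb
      simp only [cyc4, Finset.mem_insert, Finset.mem_singleton] at hb
      rcases hb with rfl | rfl | rfl | rfl
      · exact h0
      · exact ha
      · exact hadd _ ha _ ha
      · exact hadd _ (hadd _ ha _ ha) _ ha
    have e : H = cyc4 a := Finset.Subset.antisymm hsub hsup
    rcases cyc4_cases a (hten a ha) ha0 ha2 with h | h | h | h
    · exact Or.inr (Or.inr (Or.inl (e.trans h)))
    · exact Or.inr (Or.inr (Or.inr (Or.inl (e.trans h))))
    · exact Or.inr (Or.inr (Or.inr (Or.inr (Or.inl (e.trans h)))))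
    · exact Or.inr (Or.inr (Or.inr (Or.inr (Or.inr (e.trans h)))))
  · push Not at hex
    by_cases h2 : d2Vec ∈ H
    · refine Or.inr (Or.inl (Finset.Subset.antisymm (fun b hb => ?_) (fun b hb => ?_)))
      · by_cases hb0 : b = 0
        · simp [d2Sub, hb0]
        · simp [d2Sub, hex b hb hb0]
      · simp only [d2Sub, Finset.mem_insert, Finset.mem_singleton] at hb
        rcases hb with rfl | rfl
        · exact h0
        · exact h2
    · refine Or.inl (Finset.Subset.antisymm (fun b hb => ?_) (fun b hb => ?_))
      · by_cases hb0 : b = 0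
        · simp [trivSub, hb0]
        · exact absurd (hex b hb hb0 ▸ hb) h2
      · simp only [trivSub, Finset.mem_singleton] at hb
        exact hb ▸ h0

/-- the ⟨Δ²⟩-form of the dominance: a clean subgroup other than `{1}` CONTAINS `⟨Δ²⟩`. -/
theorem d2Sub_subset_of_cleanSub {H : Finset PVec} (hH : CleanSub H) (hne : H ≠ trivSub) : d2Sub ⊆ H := by
  have hex : ∃ a ∈ H, a ≠ 0 := by
    by_contra hno
    push Not at hno
    apply hne
    refine Finset.Subset.antisymm (fun b hb => by simp [trivSub, hno b hb]) fun b hb => ?_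
    simp only [trivSub, Finset.mem_singleton] at hb
    exact hb ▸ hH.1
  obtain ⟨a, ha, ha0⟩ := hex
  intro b hb
  simp only [d2Sub, Finset.mem_insert, Finset.mem_singleton] at hb
  rcases hb with rfl | rfl
  · exact hH.1
  · exact d2Vec_mem_of_cleanSub hH ha ha0

set_option synthInstance.maxSize 8192 in -- nested decidable implications
/-- **`Δ²` IS THE ONLY CLEAN INVOLUTION of `T`** («Δ² = total flip is the only clean involution»). [kernel, `decide`] -/
theorem d2Vec_unique_clean_involution : ∀ η : PVec, DetOne η → ¬ IsPartial η → η ≠ 0 → η + η = 0 → η = d2Vec := by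
  decide +kernel

/-- clean subgroups have order `1`, `2` or `4` only («nothing of order ≥ 8», «no clean (ℤ∕2)²»), and the four of order 4 are MAXIMAL
clean subgroups («MAXIMAL CLEAN», torus_windows.out). -/
theorem cleanSub_card_maximal {H : Finset PVec} (hH : CleanSub H) :
    (H.card = 1 ∨ H.card = 2 ∨ H.card = 4) ∧ (dSub ⊆ H → H = dSub) ∧ ∀ j : Fin 3, gSub j ⊆ H → H = gSub j := by
  rcases cleanSub_classification hH with rfl | rfl | rfl | rfl | rfl | rfl <;> decide

/-! ## §4 Kernel probes -/

/-- `γ_j² = Δ² = Δ·Δ`, `(Δ²)² = 1` (card W14b «γ² = Δ²»); `Δ·γ₁ = (2,2,0,0)` IS a partial move (so `⟨Δ, γ₁⟩` is not clean), while `Δ, Δ², γ_j`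
are clean generators inside `T`. [`decide`] -/
theorem torus_probes :
    (∀ j : Fin 3, gVec j + gVec j = d2Vec) ∧ dVec + dVec = d2Vec ∧ d2Vec + d2Vec = 0 ∧ dVec + gVec 0 = pv 2 2 0 0 ∧
      IsPartial (dVec + gVec 0) ∧ CleanGen dVec ∧ CleanGen d2Vec ∧ ∀ j : Fin 3, CleanGen (gVec j) := by
  decide

/-- the γ's are S₄-CONJUGATE (coordinate permutations), while `Δ` and `Δ²` are S₄-FIXED («⟨Δ⟩ (S₄-FIXED) AND three S₄-conjugate groups
of type ⟨(i,i,−i,−i)⟩», R12.2 (2)). [`decide`] -/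
theorem gVec_conjugate :
    permP (Equiv.swap 1 2) (gVec 0) = gVec 1 ∧ permP (Equiv.swap 1 3) (gVec 0) = gVec 2 ∧
      ∀ σ : Equiv.Perm (Fin 4), permP σ dVec = dVec ∧ permP σ d2Vec = d2Vec := by
  refine ⟨by decide, by decide, fun σ => ⟨funext fun f => ?_, funext fun f => ?_⟩⟩
  · have h : ∀ g : Fin 4, dVec g = 1 := by decide
    rw [permP, h, h]
  · have h : ∀ g : Fin 4, d2Vec g = 2 := by decide
    rw [permP, h, h]

/-- the stabiliser in S₄ of the WINDOW `⟨γ₁⟩` (as a set; the block swap sends `γ₁ ↦ γ₁³`) has order `8`, that of the VECTOR `γ₁ = (1,1,3,3)`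
order `4` (card W14b: «stabiliser in S₄ = the split {12}{34} (order 8), so a γ-invariant design is NOT S₄-symmetrisable without leaving the
window»). [kernel, `decide`] -/
theorem gVec_stabiliser_card :
    (univ.filter fun σ : Equiv.Perm (Fin 4) => ∀ a ∈ gSub 0, permP σ a ∈ gSub 0).card = 8 ∧
      (univ.filter fun σ : Equiv.Perm (Fin 4) => permP σ (gVec 0) = gVec 0).card = 4 := by
  unfold gSub
  decide +kernel

/-- on the four-phase fully charged cell of `Pad4TowerCrossPhase`: `Δ²` flips every `β`, the action of `γ₁` differs from `Δ`'s, both have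
order dividing 4, and `phase dVec` is `delta`. [kernel, `decide`] -/
theorem phase_probe :
    fcCell.phase d2Vec = fcCell.delta.delta ∧ fcCell.phase (gVec 0) ≠ fcCell.delta ∧
      (fcCell.phase (gVec 0)).phase (gVec 0) = fcCell.phase d2Vec ∧ fcCell.phase dVec = fcCell.delta := by
  decide +kernel

end Summit.Ventures.HSemireg.Pad4Tower
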